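import Mathlib
import HarnessLib
import Literature.MathematicalPhysics.QuantumFieldTheory.Balaban1983to89.FieldMeasureAnalyticZeroSetNull
import Literature.MathematicalPhysics.QuantumFieldTheory.Balaban1983to89.MatrixNorms
import Literature.MathematicalPhysics.QuantumFieldTheory.Balaban1983to89.MissingProofs
import Literature.MathematicalPhysics.QuantumFieldTheory.Balaban1983to89.BlockAveraging
import Literature.MathematicalPhysics.QuantumFieldTheory.Balaban1983to89.T3UnitLawDensityEML
import Summits.QuantumFields.YangMills.Theses.GuardedThresholdRemoval

/-!
# Route `GuardedThresholdRemoval`, support item `GuardCollarHaarSmall` (stmt-QuantumFields-28046), PROVED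

HAAR-SMALLNESS OF THE GUARD COLLARS.  For every torus family `F` and every `ε > 0` there is `η > 0` with
`dU{u : ∃ c i, |dist₁(W_{c,i}(u)) − δ| < η} ≤ ε`, where `dU = fieldMeasure (F.P 0) 0 SU(2)` is the product Haar probability
measure on unit-lattice configurations, `W_{c,i}(u) = BlockAveraging.loopHol u c i` are the one-step (0.4) loop variables of
[Balaban1987RG1] and `δ = (ℰp).δ` is the guard radius of the printed small-loop average.

THE PROOF (elementary measure theory, no renormalisation-group content).
* §1 Every holonomy word `holAt U γ`, read in `M_N(ℂ)`, is the ordered product of the bond matrices and their conjugate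
  transposes, hence a real-analytic function of the ambient matrix variables (`coe_holAt`, `analyticOnNhd_wordProd`); at the
  trivial configuration it is `1`.
* §2 On `SU(2)`, `dist₁(g)² = 2(1 − Re tr g)` (tree `MatrixNorms.opDist1_sq_eq_of_mem_specialUnitaryGroup_two`), so the
  sphere `{dist₁(holAt U γ) = δ}`, `δ ≠ 0`, lies in the trace level set `{Re tr(holAt U γ) = 1 − δ²/2}`, a real-analytic zero
  set not containing `U ≡ 1`; it is `dU`-null by the tree's `FieldMeasureAnalyticZeroSetNull.fieldMeasure_zeroSet_eq_zero`
  ([BrockerTomDieck1985] IV (2.11), [Mityagin2015] Prop. 1).  In particular every guard sphere `{dist₁(W_{c,i}) = δ}` is null,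
  and so is their finite union.
* §3 The collars `A_n = {u : ∃ c i, |dist₁(W_{c,i}(u)) − δ| < (n+1)⁻¹}` decrease to a subset of that union (finitely many
  `(c, i)`: `Filter.eventually_all`), so `dU(A_n) → 0` by continuity from above, and some `η = (n+1)⁻¹` works.

No summit statement and no rung is proved here; R3 is a RECORD rung and the Yang–Mills mass gap is NOT touched.
-/

noncomputable section

open Set Function Filter Topology MeasureTheory
open scoped ENNReal NNReal Matrix Matrix.Norms.L2Operator

namespace Summit.QuantumFields.YangMills.Theorems.GuardCollarHaarSmall

open Literature.MathematicalPhysics.QuantumFieldTheory.Balaban1983to89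
open Literature.MathematicalPhysics.QuantumFieldTheory.Balaban1983to89.T4Continuum
open Literature.MathematicalPhysics.QuantumFieldTheory.Balaban1983to89.T3ContinuumYM3Torus
open Literature.MathematicalPhysics.QuantumFieldTheory.Balaban1983to89.T3UnitLawDensityEML

/-! ## §1 Holonomy words read in `M_N(ℂ)`: ordered products of bond matrices and conjugate transposes, real-analytic -/

section Words

variable {N : ℕ} {P : Params} {j : ℕ}

/-- The holonomy `holAt U γ` of an `SU(N)`-configuration along a list of oriented steps, read in `M_N(ℂ)`, is the ordered product
of the bond matrices (forward steps) and their conjugate transposes (backward steps). [cite: ChatterjeeYMProb2019, §2] -/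
theorem coe_holAt [NeZero N] (U : GaugeField P j (Matrix.specialUnitaryGroup (Fin N) ℂ)) (γ : List (LStep P j)) :
    ((holAt U γ : Matrix.specialUnitaryGroup (Fin N) ℂ) : Matrix (Fin N) (Fin N) ℂ) =
      (γ.map fun s : LStep P j => if s.fwd then ((U s.bond : Matrix.specialUnitaryGroup (Fin N) ℂ) : Matrix (Fin N) (Fin N) ℂ)
        else (((U s.bond : Matrix.specialUnitaryGroup (Fin N) ℂ) : Matrix (Fin N) (Fin N) ℂ))ᴴ).prod := by
  induction γ with
  | nil => rfl
  | cons s γ ih =>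
    have h1 : holAt U (s :: γ) = (if s.fwd then U s.bond else (U s.bond)⁻¹) * holAt U γ := by
      simp only [holAt, List.map_cons, List.prod_cons]
    rw [h1, List.map_cons, List.prod_cons, Submonoid.coe_mul, ih]
    congr 1
    obtain ⟨b, f⟩ := s
    cases f <;> rfl

/-- At the trivial configuration `U ≡ 1` every holonomy is `1`. [folklore] -/
theorem holAt_one {G : Type*} [GaugeGroup G] (γ : List (LStep P j)) : holAt (fun _ : PBond P j => (1 : G)) γ = 1 := by
  induction γ with
  | nil => rfl
  | cons s γ ih =>
    have h1 : holAt (fun _ : PBond P j => (1 : G)) (s :: γ) =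
        (if s.fwd then (1 : G) else (1 : G)⁻¹) * holAt (fun _ : PBond P j => (1 : G)) γ := by
      simp only [holAt, List.map_cons, List.prod_cons]
    rw [h1, ih, mul_one]
    obtain ⟨b, f⟩ := s
    cases f <;> simp

/-- The conjugate transpose is real-analytic on `M_N(ℂ)` (an `ℝ`-linear continuous map, Mathlib `starL'`). [folklore] -/
theorem analyticAt_conjTranspose (M : Matrix (Fin N) (Fin N) ℂ) :
    AnalyticAt ℝ (fun A : Matrix (Fin N) (Fin N) ℂ => Aᴴ) M := by
  have h := ((starL' ℝ (A := Matrix (Fin N) (Fin N) ℂ)) : Matrix (Fin N) (Fin N) ℂ →L[ℝ] Matrix (Fin N) (Fin N) ℂ).analyticAt M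
  have heq : (fun A : Matrix (Fin N) (Fin N) ℂ => Aᴴ) =
      ((starL' ℝ (A := Matrix (Fin N) (Fin N) ℂ)) : Matrix (Fin N) (Fin N) ℂ →L[ℝ] Matrix (Fin N) (Fin N) ℂ) := by
    funext A
    simp [starL'_apply, Matrix.star_eq_conjTranspose]
  rw [heq]; exact h

/-- The word product `A ↦ Π_s A_{b(s)}^{(ᴴ)}` of a list of oriented steps is real-analytic on the whole product of matrix spaces
(finite products of coordinate projections and conjugate transposes). [folklore] -/
theorem analyticOnNhd_wordProd (γ : List (LStep P j)) :
    AnalyticOnNhd ℝ (fun A : PBond P j → Matrix (Fin N) (Fin N) ℂ =>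
      (γ.map fun s : LStep P j => if s.fwd then A s.bond else (A s.bond)ᴴ).prod) Set.univ := by
  intro A _
  have hproj : ∀ b : PBond P j, AnalyticAt ℝ (fun A : PBond P j → Matrix (Fin N) (Fin N) ℂ => A b) A := fun b =>
    (ContinuousLinearMap.proj (R := ℝ) (φ := fun _ : PBond P j => Matrix (Fin N) (Fin N) ℂ) b).analyticAt A
  induction γ with
  | nil =>
    simp only [List.map_nil, List.prod_nil]
    exact analyticAt_const
  | cons s γ ih =>
    simp only [List.map_cons, List.prod_cons]
    refine AnalyticAt.mul ?_ ih
    obtain ⟨b, f⟩ := s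
    cases f
    · simp only [Bool.false_eq_true, ↓reduceIte]
      exact (analyticAt_conjTranspose _).comp (hproj b)
    · simp only [↓reduceIte]
      exact hproj b

end Words

/-! ## §2 On `SU(2)` the spheres `{dist₁(holAt U γ) = δ}`, `δ ≠ 0`, are `dU`-null -/

section Spheres

variable {P : Params} {j : ℕ}

/-- On `SU(2)`: `Re tr g = 1 − ½·dist₁(g)²` ([Balaban1987RG1] (0.14) as an operator-norm identity, tree
`MatrixNorms.opDist1_sq_eq_of_mem_specialUnitaryGroup_two`). [cite: Balaban1987RG1, (0.14) p.254] -/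
theorem reTr_eq_one_sub_half_dist1_sq (g : Matrix.specialUnitaryGroup (Fin 2) ℂ) :
    reTr g = 1 - 1 / 2 * dist1 g ^ 2 := by
  have h := MatrixNorms.opDist1_sq_eq_of_mem_specialUnitaryGroup_two g.2
  have hd : dist1 g = UnitaryModel.opDist1 (g : Matrix (Fin 2) (Fin 2) ℂ) := rfl
  have hr : reTr g = UnitaryModel.nReTr (g : Matrix (Fin 2) (Fin 2) ℂ) := rfl
  rw [hd, hr, h]
  ring

/-- **TRACE LEVEL SETS OF HOLONOMY WORDS ARE `dU`-NULL**: for every list of oriented steps `γ` of `T^{(j)}` and every `t ≠ 1`,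
`dU{U : Re tr 𝒰(γ) = t} = 0` on `SU(2)`-configurations (real-analytic zero set of `A ↦ Re tr Π_s A_{b(s)}^{(ᴴ)} − t`, non-zero
at `U ≡ 1`). [cite: BrockerTomDieck1985, IV (2.11) (proof)] -/
theorem fieldMeasure_setOf_reTr_holAt_eq_eq_zero (γ : List (LStep P j)) {t : ℝ} (ht : t ≠ 1) :
    fieldMeasure P j (Matrix.specialUnitaryGroup (Fin 2) ℂ)
      {U : GaugeField P j (Matrix.specialUnitaryGroup (Fin 2) ℂ) | reTr (holAt U γ) = t} = 0 := by
  set F : (PBond P j → Matrix (Fin 2) (Fin 2) ℂ) → ℂ := fun A =>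
    ((UnitaryModel.nReTr ((γ.map fun s : LStep P j => if s.fwd then A s.bond else (A s.bond)ᴴ).prod) : ℝ) : ℂ) - (t : ℂ)
    with hFdef
  have hF : AnalyticOnNhd ℝ F Set.univ := by
    intro A _
    exact ((FieldMeasureAnalyticZeroSetNull.analyticOnNhd_nReTr _ (Set.mem_univ _)).comp
      (analyticOnNhd_wordProd γ A (Set.mem_univ _))).sub analyticAt_const
  have hset : {U : GaugeField P j (Matrix.specialUnitaryGroup (Fin 2) ℂ) | reTr (holAt U γ) = t} =
      {U | F (fun b => ((U b : Matrix.specialUnitaryGroup (Fin 2) ℂ) : Matrix (Fin 2) (Fin 2) ℂ)) = 0} := by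
    ext U
    have hr : reTr (holAt U γ) = UnitaryModel.nReTr ((holAt U γ : Matrix.specialUnitaryGroup (Fin 2) ℂ) : Matrix (Fin 2) (Fin 2) ℂ) := rfl
    simp only [Set.mem_setOf_eq, hFdef, hr, coe_holAt, sub_eq_zero, Complex.ofReal_inj]
  rw [hset]
  refine FieldMeasureAnalyticZeroSetNull.fieldMeasure_zeroSet_eq_zero P j hF ⟨fun _ => 1, ?_⟩
  have h1 : (γ.map fun s : LStep P j => if s.fwd then (((fun _ : PBond P j => (1 : Matrix.specialUnitaryGroup (Fin 2) ℂ)) s.bond :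
      Matrix.specialUnitaryGroup (Fin 2) ℂ) : Matrix (Fin 2) (Fin 2) ℂ) else ((((fun _ : PBond P j =>
      (1 : Matrix.specialUnitaryGroup (Fin 2) ℂ)) s.bond : Matrix.specialUnitaryGroup (Fin 2) ℂ) : Matrix (Fin 2) (Fin 2) ℂ))ᴴ).prod = 1 := by
    rw [← coe_holAt (fun _ : PBond P j => (1 : Matrix.specialUnitaryGroup (Fin 2) ℂ)) γ, holAt_one]
    rfl
  simp only [hFdef, h1, UnitaryModel.nReTr_one, Complex.ofReal_one, ne_eq, sub_eq_zero]
  exact_mod_cast ht.symm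

/-- **SPHERES AROUND `1` OF HOLONOMY WORDS ARE `dU`-NULL ON `SU(2)`**: `dU{U : dist₁(𝒰(γ)) = δ} = 0` for every `δ ≠ 0`
(`dist₁² = 2(1 − Re tr)` puts the sphere inside the trace level set `Re tr = 1 − δ²/2 ≠ 1`). [cite: BrockerTomDieck1985, IV (2.11) (proof)] -/
theorem fieldMeasure_setOf_dist1_holAt_eq_eq_zero (γ : List (LStep P j)) {δ : ℝ} (hδ : δ ≠ 0) :
    fieldMeasure P j (Matrix.specialUnitaryGroup (Fin 2) ℂ)
      {U : GaugeField P j (Matrix.specialUnitaryGroup (Fin 2) ℂ) | dist1 (holAt U γ) = δ} = 0 := by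
  refine measure_mono_null (fun U hU => ?_) (fieldMeasure_setOf_reTr_holAt_eq_eq_zero γ (t := 1 - 1 / 2 * δ ^ 2) ?_)
  · simp only [Set.mem_setOf_eq] at hU ⊢
    rw [reTr_eq_one_sub_half_dist1_sq, hU]
  · intro h
    have : δ ^ 2 = 0 := by linarith
    exact hδ (pow_eq_zero_iff two_ne_zero |>.mp this)

/-- **THE GUARD SPHERES OF THE ONE-STEP (0.4) LOOPS ARE `dU`-NULL**: for every coarse bond `c`, index `i` and `δ ≠ 0`,
`dU{u : dist₁(W_{c,i}(u)) = δ} = 0`. [cite: Balaban1987RG1, (0.4) p.253] -/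
theorem fieldMeasure_setOf_dist1_loopHol_eq_eq_zero (c : PBond P (j + 1)) (i : BlockAveraging.Idx P) {δ : ℝ} (hδ : δ ≠ 0) :
    fieldMeasure P j (Matrix.specialUnitaryGroup (Fin 2) ℂ)
      {u : GaugeField P j (Matrix.specialUnitaryGroup (Fin 2) ℂ) | dist1 (BlockAveraging.loopHol u c i) = δ} = 0 :=
  fieldMeasure_setOf_dist1_holAt_eq_eq_zero _ hδ

/-- The union of all guard spheres of level `j` is `dU`-null (finitely many `(c, i)`). [cite: Balaban1987RG1, (0.4) p.253] -/
theorem fieldMeasure_setOf_exists_dist1_loopHol_eq_eq_zero {δ : ℝ} (hδ : δ ≠ 0) :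
    fieldMeasure P j (Matrix.specialUnitaryGroup (Fin 2) ℂ)
      {u : GaugeField P j (Matrix.specialUnitaryGroup (Fin 2) ℂ) |
        ∃ (c : PBond P (j + 1)) (i : BlockAveraging.Idx P), dist1 (BlockAveraging.loopHol u c i) = δ} = 0 := by
  have hset : {u : GaugeField P j (Matrix.specialUnitaryGroup (Fin 2) ℂ) |
        ∃ (c : PBond P (j + 1)) (i : BlockAveraging.Idx P), dist1 (BlockAveraging.loopHol u c i) = δ} =
      ⋃ c : PBond P (j + 1), ⋃ i : BlockAveraging.Idx P,
        {u : GaugeField P j (Matrix.specialUnitaryGroup (Fin 2) ℂ) | dist1 (BlockAveraging.loopHol u c i) = δ} := by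
    ext u; simp only [Set.mem_setOf_eq, Set.mem_iUnion]
  rw [hset]
  exact measure_iUnion_null fun c => measure_iUnion_null fun i => fieldMeasure_setOf_dist1_loopHol_eq_eq_zero c i hδ

end Spheres

/-! ## §3 Continuity from above along the shrinking collars -/

section Collars

variable {P : Params} {j : ℕ}

/-- The collar of width `η` around the guard spheres is measurable (continuous loop variables and `dist₁`). [folklore] -/
theorem measurableSet_collar (δ η : ℝ) :
    MeasurableSet {u : GaugeField P j (Matrix.specialUnitaryGroup (Fin 2) ℂ) |
      ∃ (c : PBond P (j + 1)) (i : BlockAveraging.Idx P), |dist1 (BlockAveraging.loopHol u c i) - δ| < η} := by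
  have hset : {u : GaugeField P j (Matrix.specialUnitaryGroup (Fin 2) ℂ) |
        ∃ (c : PBond P (j + 1)) (i : BlockAveraging.Idx P), |dist1 (BlockAveraging.loopHol u c i) - δ| < η} =
      ⋃ c : PBond P (j + 1), ⋃ i : BlockAveraging.Idx P,
        {u : GaugeField P j (Matrix.specialUnitaryGroup (Fin 2) ℂ) | |dist1 (BlockAveraging.loopHol u c i) - δ| < η} := by
    ext u; simp only [Set.mem_setOf_eq, Set.mem_iUnion]
  rw [hset]
  refine MeasurableSet.iUnion fun c => MeasurableSet.iUnion fun i => measurableSet_lt ?_ measurable_const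
  have hm : Measurable fun u : GaugeField P j (Matrix.specialUnitaryGroup (Fin 2) ℂ) => dist1 (BlockAveraging.loopHol u c i) :=
    RegularGaugeGroup.measurable_dist1.comp ((measurable_pi_apply i).comp (BlockAveraging.measurable_loopHol c))
  exact (hm.sub measurable_const).abs

/-- **HAAR-SMALLNESS OF THE GUARD COLLARS AT EVERY LEVEL**: for every torus datum `P`, level `j`, radius `δ ≠ 0` and `ε > 0`
there is `η > 0` with `dU{u : ∃ c i, |dist₁(W_{c,i}(u)) − δ| < η} ≤ ε` (`dU` the product Haar probability measure on
`SU(2)`-configurations of `T^{(j)}`). [cite: Balaban1987RG1, (0.4) p.253] -/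
theorem exists_collar_le (P : Params) (j : ℕ) {δ : ℝ} (hδ : δ ≠ 0) {ε : ℝ} (hε : 0 < ε) :
    ∃ η : ℝ, 0 < η ∧ (fieldMeasure P j (Matrix.specialUnitaryGroup (Fin 2) ℂ)).real
      {u : GaugeField P j (Matrix.specialUnitaryGroup (Fin 2) ℂ) |
        ∃ (c : PBond P (j + 1)) (i : BlockAveraging.Idx P), |dist1 (BlockAveraging.loopHol u c i) - δ| < η} ≤ ε := by
  set μ := fieldMeasure P j (Matrix.specialUnitaryGroup (Fin 2) ℂ) with hμ
  haveI : IsProbabilityMeasure μ := Missing.isProbabilityMeasure_fieldMeasure P j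
  -- the shrinking collars
  set A : ℕ → Set (GaugeField P j (Matrix.specialUnitaryGroup (Fin 2) ℂ)) := fun n =>
    {u | ∃ (c : PBond P (j + 1)) (i : BlockAveraging.Idx P),
      |dist1 (BlockAveraging.loopHol u c i) - δ| < ((n : ℝ) + 1)⁻¹} with hA
  have hanti : Antitone A := by
    intro m n hmn u hu
    obtain ⟨c, i, h⟩ := hu
    refine ⟨c, i, h.trans_le ?_⟩
    exact inv_anti₀ (by positivity) (by exact_mod_cast Nat.succ_le_succ hmn)
  have hmeas : ∀ n, NullMeasurableSet (A n) μ := fun n => (measurableSet_collar δ _).nullMeasurableSet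
  -- their intersection lies in the union of the guard spheres
  have hinter : ⋂ n, A n ⊆ {u | ∃ (c : PBond P (j + 1)) (i : BlockAveraging.Idx P), dist1 (BlockAveraging.loopHol u c i) = δ} := by
    intro u hu
    rw [Set.mem_iInter] at hu
    by_contra hne
    simp only [Set.mem_setOf_eq, not_exists] at hne
    -- every `|dist₁(W_{c,i}(u)) − δ|` is positive; finitely many pairs, so one width `(n+1)⁻¹` is below all of them
    have hev : ∀ᶠ n : ℕ in atTop, ∀ p : PBond P (j + 1) × BlockAveraging.Idx P,
        ((n : ℝ) + 1)⁻¹ ≤ |dist1 (BlockAveraging.loopHol u p.1 p.2) - δ| := by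
      refine eventually_all.mpr fun p => ?_
      have hpos : 0 < |dist1 (BlockAveraging.loopHol u p.1 p.2) - δ| := abs_pos.mpr (sub_ne_zero.mpr (hne p.1 p.2))
      have ht : Tendsto (fun n : ℕ => ((n : ℝ) + 1)⁻¹) atTop (𝓝 0) := tendsto_one_div_add_atTop_nhds_zero_nat.congr fun n => one_div _
      exact (ht.eventually (eventually_le_nhds hpos)).mono fun n hn => hn
    obtain ⟨n, hn⟩ := hev.exists
    obtain ⟨c, i, hlt⟩ := hu n
    exact absurd (hn (c, i)) (not_le.mpr hlt)
  have hlim : Tendsto (fun n => μ (A n)) atTop (𝓝 (μ (⋂ n, A n))) :=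
    tendsto_measure_iInter_atTop hmeas hanti ⟨0, measure_ne_top μ _⟩
  have hzero : μ (⋂ n, A n) = 0 :=
    measure_mono_null hinter (fieldMeasure_setOf_exists_dist1_loopHol_eq_eq_zero hδ)
  rw [hzero] at hlim
  have hev : ∀ᶠ n in atTop, μ (A n) ≤ ENNReal.ofReal ε :=
    (ENNReal.tendsto_atTop_zero.mp hlim) (ENNReal.ofReal ε) (ENNReal.ofReal_pos.mpr hε) |>.elim
      fun N hN => eventually_atTop.mpr ⟨N, hN⟩
  obtain ⟨n, hn⟩ := hev.exists
  refine ⟨((n : ℝ) + 1)⁻¹, by positivity, ?_⟩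
  show μ.real (A n) ≤ ε
  exact (ENNReal.toReal_le_toReal (measure_ne_top μ _) ENNReal.ofReal_ne_top).mpr hn |>.trans_eq (ENNReal.toReal_ofReal hε.le)

end Collars

end Summit.QuantumFields.YangMills.Theorems.GuardCollarHaarSmall

namespace Summit.QuantumFields.YangMills.Theorems

open Literature.MathematicalPhysics.QuantumFieldTheory.Balaban1983to89
open Literature.MathematicalPhysics.QuantumFieldTheory.Balaban1983to89.T3ContinuumYM3Torus
open Literature.MathematicalPhysics.QuantumFieldTheory.Balaban1983to89.T3UnitLawDensityEML

/-- **Item stmt-QuantumFields-28046 `GuardCollarHaarSmall`, PROVED**: for every torus family `F` and `ε > 0` there is `η > 0` with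
`dU{u : ∃ c i, |dist₁(W_{c,i}(u)) − δ| < η} ≤ ε` on the unit lattice (`dU = fieldMeasure (F.P 0) 0 SU(2)`, `δ = (ℰp).δ > 0`);
instance `P = F.P 0`, `j = 0` of `GuardCollarHaarSmall.exists_collar_le`.  Support item only: no crux of the route, no rung and
no summit statement is proved by this. [cite: Balaban1987RG1, (0.4) p.253] -/
theorem guardedThresholdRemoval_guardCollarHaarSmall_proof :
    Summit.QuantumFields.YangMills.Theses.GuardedThresholdRemoval.GuardCollarHaarSmall := by
  intro F ε hε
  exact GuardCollarHaarSmall.exists_collar_le (F.P 0) 0 (ne_of_gt (ℰp).δ_pos) hε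

end Summit.QuantumFields.YangMills.Theorems

/-! ## §4 (appended) Thin guard collars under every law absolutely continuous w.r.t. `dU`; the unit laws at each FIXED cut-off

The parent crux `GuardSphereThin` (stmt-QuantumFields-28025) asks for a collar width `η` that works for ALL cut-offs `K ≥ K₀`.  At each
FIXED `K` the statement is automatic: the unit law `unitLaw_K = Z_K⁻¹ρ̂_K · dU` has a density with respect to product Haar (tree
`T3UnitLawDensityEML.unitLaw_eq_withDensity_emlDensity`), so it charges the `dU`-null union of the guard spheres with mass `0`, and
continuity from above along the shrinking collars gives `η = η(F, γ, K, ε)`.  This is the witness of weakness for 28025: its whole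
content is the UNIFORMITY of `η` in `K` (equivalently the crux `UnitLawCollarDominated`, stmt-QuantumFields-28045); nothing below is
uniform in `K`, and no crux, rung or summit statement is proved by it. -/

namespace Summit.QuantumFields.YangMills.Theorems.GuardCollarHaarSmall

open Literature.MathematicalPhysics.QuantumFieldTheory.Balaban1983to89
open Literature.MathematicalPhysics.QuantumFieldTheory.Balaban1983to89.T4Continuum
open Literature.MathematicalPhysics.QuantumFieldTheory.Balaban1983to89.T3ContinuumYM3Torus
open Literature.MathematicalPhysics.QuantumFieldTheory.Balaban1983to89.T3UnitLawDensityEML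

section AbsolutelyContinuous

variable {P : Params} {j : ℕ}

/-- **THIN GUARD COLLARS UNDER EVERY `dU`-ABSOLUTELY-CONTINUOUS FINITE LAW**: for a finite measure `ν ≪ dU` on the
`SU(2)`-configurations of `T^{(j)}`, every `δ ≠ 0` and `ε > 0` there is `η > 0` with `ν{u : ∃ c i, |dist₁(W_{c,i}(u)) − δ| < η} ≤ ε`
(the collars decrease to a subset of the `dU`-null union of the guard spheres, which is `ν`-null). [cite: Balaban1987RG1, (0.4) p.253] -/
theorem exists_collar_le_of_absolutelyContinuous (P : Params) (j : ℕ) {δ : ℝ} (hδ : δ ≠ 0)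
    (ν : Measure (GaugeField P j (Matrix.specialUnitaryGroup (Fin 2) ℂ))) [IsFiniteMeasure ν]
    (hν : ν ≪ fieldMeasure P j (Matrix.specialUnitaryGroup (Fin 2) ℂ)) {ε : ℝ} (hε : 0 < ε) :
    ∃ η : ℝ, 0 < η ∧ ν.real
      {u : GaugeField P j (Matrix.specialUnitaryGroup (Fin 2) ℂ) |
        ∃ (c : PBond P (j + 1)) (i : BlockAveraging.Idx P), |dist1 (BlockAveraging.loopHol u c i) - δ| < η} ≤ ε := by
  -- the shrinking collars
  set A : ℕ → Set (GaugeField P j (Matrix.specialUnitaryGroup (Fin 2) ℂ)) := fun n =>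
    {u | ∃ (c : PBond P (j + 1)) (i : BlockAveraging.Idx P),
      |dist1 (BlockAveraging.loopHol u c i) - δ| < ((n : ℝ) + 1)⁻¹} with hA
  have hanti : Antitone A := by
    intro m n hmn u hu
    obtain ⟨c, i, h⟩ := hu
    refine ⟨c, i, h.trans_le ?_⟩
    exact inv_anti₀ (by positivity) (by exact_mod_cast Nat.succ_le_succ hmn)
  have hmeas : ∀ n, NullMeasurableSet (A n) ν := fun n => (measurableSet_collar δ _).nullMeasurableSet
  -- their intersection lies in the union of the guard spheres
  have hinter : ⋂ n, A n ⊆ {u | ∃ (c : PBond P (j + 1)) (i : BlockAveraging.Idx P), dist1 (BlockAveraging.loopHol u c i) = δ} := by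
    intro u hu
    rw [Set.mem_iInter] at hu
    by_contra hne
    simp only [Set.mem_setOf_eq, not_exists] at hne
    have hev : ∀ᶠ n : ℕ in atTop, ∀ p : PBond P (j + 1) × BlockAveraging.Idx P,
        ((n : ℝ) + 1)⁻¹ ≤ |dist1 (BlockAveraging.loopHol u p.1 p.2) - δ| := by
      refine eventually_all.mpr fun p => ?_
      have hpos : 0 < |dist1 (BlockAveraging.loopHol u p.1 p.2) - δ| := abs_pos.mpr (sub_ne_zero.mpr (hne p.1 p.2))
      have ht : Tendsto (fun n : ℕ => ((n : ℝ) + 1)⁻¹) atTop (𝓝 0) := tendsto_one_div_add_atTop_nhds_zero_nat.congr fun n => one_div _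
      exact (ht.eventually (eventually_le_nhds hpos)).mono fun n hn => hn
    obtain ⟨n, hn⟩ := hev.exists
    obtain ⟨c, i, hlt⟩ := hu n
    exact absurd (hn (c, i)) (not_le.mpr hlt)
  have hlim : Tendsto (fun n => ν (A n)) atTop (𝓝 (ν (⋂ n, A n))) :=
    tendsto_measure_iInter_atTop hmeas hanti ⟨0, measure_ne_top ν _⟩
  have hzero : ν (⋂ n, A n) = 0 :=
    measure_mono_null hinter (hν (fieldMeasure_setOf_exists_dist1_loopHol_eq_eq_zero hδ))
  rw [hzero] at hlim
  have hev : ∀ᶠ n in atTop, ν (A n) ≤ ENNReal.ofReal ε :=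
    (ENNReal.tendsto_atTop_zero.mp hlim) (ENNReal.ofReal ε) (ENNReal.ofReal_pos.mpr hε) |>.elim
      fun N hN => eventually_atTop.mpr ⟨N, hN⟩
  obtain ⟨n, hn⟩ := hev.exists
  refine ⟨((n : ℝ) + 1)⁻¹, by positivity, ?_⟩
  show ν.real (A n) ≤ ε
  exact (ENNReal.toReal_le_toReal (measure_ne_top ν _) ENNReal.ofReal_ne_top).mpr hn |>.trans_eq (ENNReal.toReal_ofReal hε.le)

end AbsolutelyContinuous

/-- **GUARD-SPHERE THINNESS OF THE UNIT LAWS AT EACH FIXED CUT-OFF** (witness of weakness for `GuardSphereThin`,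
stmt-QuantumFields-28025): for every torus family `F`, coupling `γ ≥ 0`, cut-off `K` and `ε > 0` there is `η = η(F, γ, K, ε) > 0`
with `unitLaw_K{u : ∃ c i, |dist₁(W_{c,i}(u)) − δ| < η} ≤ ε` — because `unitLaw_K` has the density `Z_K⁻¹ρ̂_K` w.r.t. product Haar
(tree `T3UnitLawDensityEML.unitLaw_eq_withDensity_emlDensity`).  The crux `GuardSphereThin` is this with `η` UNIFORM in `K ≥ K₀`
(and `γ ≤ γ₂`); that uniformity is NOT proved here. [cite: Balaban1985UV3, (2) p.256] -/
theorem unitLaw_collar_le_at (F : T3Family) {γ : ℝ} (hγ : 0 ≤ γ) (K : ℕ) {ε : ℝ} (hε : 0 < ε) :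
    ∃ η : ℝ, 0 < η ∧ (F.unitLaw ℰp measurableE_ℰp γ K).real
      {u : GaugeField (F.P 0) 0 (Matrix.specialUnitaryGroup (Fin 2) ℂ) |
        ∃ (c : PBond (F.P 0) 1) (i : BlockAveraging.Idx (F.P 0)),
          |dist1 (BlockAveraging.loopHol u c i) - (ℰp).δ| < η} ≤ ε := by
  haveI : IsProbabilityMeasure (F.unitLaw ℰp measurableE_ℰp γ K) :=
    T3ThresholdRemoval.isProbabilityMeasure_unitLaw (F := F) (ℰ := ℰp) measurableE_ℰp hγ K
  have hν : F.unitLaw ℰp measurableE_ℰp γ K ≪ fieldMeasure (F.P 0) 0 (Matrix.specialUnitaryGroup (Fin 2) ℂ) := by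
    rw [unitLaw_eq_withDensity_emlDensity F K hγ]
    exact withDensity_absolutelyContinuous _ _
  exact exists_collar_le_of_absolutelyContinuous (F.P 0) 0 (ne_of_gt (ℰp).δ_pos) _ hν hε

end Summit.QuantumFields.YangMills.Theorems.GuardCollarHaarSmall
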